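import Summits.Ventures.LatticeQCDFlow.TrivializingMaps.FisherZeroRadiusSharp
import Summits.Ventures.LatticeQCDFlow.TrivializingMaps.FisherStaircase
import Summits.Ventures.LatticeQCDFlow.TrivializingMaps.FisherStaircaseLength

/-!
HONEST FRAMING: exact (Metropolis-corrected) sampling algorithms for lattice gauge theory; figures
of merit are autocorrelation/cost numbers at stated couplings and volumes; no continuum-physics
claim.

# WilsonStaircaseCountExplicit — an EXPLICIT, VOLUME-INDEPENDENT lower bound on the number of stages
# of a perturbative coupling-continuation staircase for the Wilson action:
# `K · log(1/η) ≥ log((x_K + 8)/(x₀ + 8))` for `SU(2)`, `log((x_K + 8n)/(x₀ + 8n))` for `n ≥ 3`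
# (lean-2 GEN-7, ours)

Venture-side (OURS).  Cell `lqcd-flow` (pub-lqcd), unit `pub-lqcd-lean-2-g7`, 2026-08-22.

THEOREM S (theory-1 row 92b, `FisherStaircase`) prices an `η`-margined staircase
`x₀ ≤ x₁ ≤ … ≤ x_K` of re-expanded flow-constant series (stage `k` summable at
`x_k + Δ_k/(1-η)`) by every Fisher zero `s₀`:
`K·log(1/η) ≥ arsinh((x_K − Re s₀)/|Im s₀|) − arsinh((x₀ − Re s₀)/|Im s₀|) = ∫_{x₀}^{x_K} dt/|t − s₀|`.
`FisherZeroRadiusSharp` (this generation) supplies, for the `SU(n)` Wilson action in EVERY volume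
`L ≥ 2` (`d ≥ 2`), a zero with `|s₀| ≤ ρ_n := 4n/m₂(n)` (`= 8` for `SU(2)`, `8n` for `n ≥ 3`).  Since
`|t − s₀| ≤ t + ρ_n` for `t ≥ 0`, the two combine to a bound with NO unknown in it:

* `Staircase.log_div_le_arsinh_sub` (pure): `‖z‖ ≤ ρ`, `Im z ≠ 0`, `0 ≤ a ≤ b` `⇒`
  `log((b + ρ)/(a + ρ)) ≤ arsinh((b − Re z)/|Im z|) − arsinh((a − Re z)/|Im z|)`;
* **`wilson_staircase_count_ge_log`** — for `d ≥ 2`, `n ≥ 2`, EVERY `L ≥ 2`, every `0 < η < 1` and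
  every `η`-margined admissible staircase with `0 ≤ x₀`:
  `log((x_K + ρ_n)/(x₀ + ρ_n)) ≤ K·log(1/η)`;
* **`wilson_su2_staircase_count_ge_log`**: `log((x_K + 8)/(x₀ + 8)) ≤ K·log(1/η)`;
  **`wilson_sun_staircase_count_ge_log`** (`n ≥ 3`): `log((x_K + 8n)/(x₀ + 8n)) ≤ K·log(1/η)`.

Reading (value-free): to continue Lüscher's flow-constant series of the `SU(2)` Wilson action from
`s = 0` to coupling `s` (`β = 2s` in the normalisation `β∑(1 − ½Re tr U_p)`) by `η`-margined
re-expansions takes at least `log(1 + s/8)/log(1/η)` stages, in every periodic volume `L ≥ 2` — the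
first stage count of the programme with no unlocated quantity in it.  It is logarithmic in `s`
because it uses ONE zero; the several-zeros form of THEOREM S (`FisherStaircaseZeroSet`) improves it
wherever more zeros are located.

NOT CLAIMED: that the bound is anywhere near the true count (at `s ≤ 8` it is below one stage);
anything about other continuation schemes; cost / autocorrelation / continuum statements.
-/

open MeasureTheory ProbabilityTheory Filter Topology Complex Set Metric intervalIntegral
open Literature.MathematicalPhysics.QuantumFieldTheory
open Literature.MathematicalPhysics.QuantumFieldTheory.Luscher2010
open Literature.MathematicalPhysics.QuantumFieldTheory.WilsonFlow (coeConfig continuous_coeConfig)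
open scoped Matrix Matrix.Norms.Frobenius ContDiff

namespace Summit.Ventures.LatticeQCDFlow.TrivializingMaps

namespace Staircase

/-- **One located zero prices the staircase logarithmically.**  If `‖z‖ ≤ ρ`, `Im z ≠ 0` and
`0 ≤ a ≤ b`, then `log((b + ρ)/(a + ρ)) ≤ arsinh((b − Re z)/|Im z|) − arsinh((a − Re z)/|Im z|)`
(`= ∫_a^b dt/‖t − z‖`, and `‖t − z‖ ≤ t + ρ` on `[a, b]`). [ours] -/
theorem log_div_le_arsinh_sub {z : ℂ} (hz : z.im ≠ 0) {ρ a b : ℝ} (hzρ : ‖z‖ ≤ ρ) (ha : 0 ≤ a)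
    (hab : a ≤ b) :
    Real.log ((b + ρ) / (a + ρ)) ≤
      Real.arsinh ((b - z.re) / |z.im|) - Real.arsinh ((a - z.re) / |z.im|) := by
  have hzpos : 0 < ‖z‖ := norm_pos_iff.mpr fun h => hz (by rw [h]; simp)
  have hρ : 0 < ρ := hzpos.trans_le hzρ
  rw [← integral_inv_norm_ofReal_sub hz a b]
  have hne : ∀ t : ℝ, ‖(t : ℂ) - z‖ ≠ 0 := by
    intro t h0
    have : ((t : ℂ) - z).im = 0 := by rw [norm_eq_zero.mp h0]; simp
    simp [hz] at this
  have hlog : ∫ t in a..b, (t + ρ)⁻¹ = Real.log ((b + ρ) / (a + ρ)) := by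
    rw [intervalIntegral.integral_comp_add_right (fun u : ℝ => u⁻¹) ρ, integral_inv]
    refine fun h0 => ?_
    rcases mem_uIcc.mp h0 with ⟨h1, _⟩ | ⟨h1, _⟩ <;> linarith
  rw [← hlog]
  refine intervalIntegral.integral_mono_on hab ?_ ?_ fun t ht => ?_
  · refine intervalIntegral.intervalIntegrable_inv (fun t ht => ?_)
      (continuous_id.add continuous_const).continuousOn
    rcases mem_uIcc.mp ht with ⟨h1, _⟩ | ⟨h1, _⟩
    · exact ne_of_gt (by simpa using (show 0 < t + ρ by linarith))
    · exact ne_of_gt (by simpa using (show 0 < t + ρ by linarith))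
  · exact ((Complex.continuous_ofReal.sub continuous_const).norm.inv₀ hne).intervalIntegrable a b
  · have ht0 : 0 ≤ t := ha.trans ht.1
    have hpos : 0 < ‖(t : ℂ) - z‖ := (norm_nonneg _).lt_of_ne (hne t).symm
    refine inv_anti₀ hpos ?_
    calc ‖(t : ℂ) - z‖ ≤ ‖(t : ℂ)‖ + ‖z‖ := norm_sub_le _ _
      _ ≤ t + ρ := by rw [Complex.norm_real, Real.norm_eq_abs, abs_of_nonneg ht0]; linarith

end Staircase

/-! ## The Wilson action: explicit stage counts in every volume -/

section Wilson

variable {d L n : ℕ} [NeZero L]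

/-- From a monotone chain `x 0 ≤ x 1 ≤ … ≤ x K`: `x 0 ≤ x K`. -/
theorem chain_le_last {x : ℕ → ℝ} {K : ℕ} (hmono : ∀ k < K, x k ≤ x (k + 1)) : x 0 ≤ x K := by
  have h : ∀ m, m ≤ K → x 0 ≤ x m := by
    intro m
    induction m with
    | zero => intro; exact le_rfl
    | succ m ih =>
        intro hm
        exact (ih (Nat.le_of_succ_le hm)).trans (hmono m (Nat.lt_of_succ_le hm))
  exact h K le_rfl

/-- **EXPLICIT STAGE COUNT, `SU(n)` Wilson action, every volume.**  For `d ≥ 2`, `n ≥ 2`, EVERY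
`L ≥ 2`, `0 < η < 1` and every `η`-margined admissible staircase `0 ≤ x₀ ≤ … ≤ x_K` of re-expanded
flow-constant series (`Z_L′/Z_L` re-expanded at `x_k`, summable at `x_k + Δ_k/(1-η)`):
`log((x_K + ρ_n)/(x₀ + ρ_n)) ≤ K·log(1/η)` with `ρ_n = 4n/m₂(n)`, `m₂(n) = ∫_{SU(n)}(Re tr)² dHaar`.
[ours] -/
theorem wilson_staircase_count_ge_log (hd : 2 ≤ d) (hn : 2 ≤ n) (hL : 2 ≤ L)
    {η : ℝ} (hη0 : 0 < η) (hη1 : η < 1) {K : ℕ} {x : ℕ → ℝ} (hx0 : 0 ≤ x 0)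
    (hmono : ∀ k < K, x k ≤ x (k + 1))
    (hadm : ∀ k < K, Summable fun j : ℕ => (j.factorial : ℂ)⁻¹ *
      iteratedDeriv j (fun w => deriv (complexMGF (fun U => -ambWilsonAction (coeConfig U))
          (trivialMeasure (Matrix.specialUnitaryGroup (Fin n) ℂ) d L)) w /
        complexMGF (fun U => -ambWilsonAction (coeConfig U))
          (trivialMeasure (Matrix.specialUnitaryGroup (Fin n) ℂ) d L) w) (x k) *
      (((x k + (x (k + 1) - x k) / (1 - η) : ℝ) : ℂ) - x k) ^ j) :
    Real.log ((x K + 4 * n / ∫ g, ((g : Matrix (Fin n) (Fin n) ℂ)).trace.re ^ 2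
          ∂(haarProbability (Matrix.specialUnitaryGroup (Fin n) ℂ))) /
        (x 0 + 4 * n / ∫ g, ((g : Matrix (Fin n) (Fin n) ℂ)).trace.re ^ 2
          ∂(haarProbability (Matrix.specialUnitaryGroup (Fin n) ℂ)))) ≤
      K * Real.log (1 / η) := by
  obtain ⟨s₀, hs₀, hz⟩ := wilson_exists_fisherZero_norm_le (d := d) (L := L) (n := n) hd hn hL
  have him : s₀.im ≠ 0 :=
    im_ne_zero_of_actionZ_eq_zero (d := d) (L := L) (n := n) contDiff_ambWilsonAction hz
  exact (Staircase.log_div_le_arsinh_sub him hs₀ hx0 (chain_le_last hmono)).trans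
    (wilson_staircase_arsinh_le hz hη0 hη1 hmono hadm)

/-- **`SU(2)`: `log((x_K + 8)/(x₀ + 8)) ≤ K·log(1/η)`** — from coupling `0` to coupling `s` an
`η`-margined staircase has at least `log(1 + s/8)/log(1/η)` stages, in every volume `L ≥ 2`
(`d ≥ 2`). [ours] -/
theorem wilson_su2_staircase_count_ge_log (hd : 2 ≤ d) (hL : 2 ≤ L)
    {η : ℝ} (hη0 : 0 < η) (hη1 : η < 1) {K : ℕ} {x : ℕ → ℝ} (hx0 : 0 ≤ x 0)
    (hmono : ∀ k < K, x k ≤ x (k + 1))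
    (hadm : ∀ k < K, Summable fun j : ℕ => (j.factorial : ℂ)⁻¹ *
      iteratedDeriv j (fun w => deriv (complexMGF (fun U => -ambWilsonAction (coeConfig U))
          (trivialMeasure (Matrix.specialUnitaryGroup (Fin 2) ℂ) d L)) w /
        complexMGF (fun U => -ambWilsonAction (coeConfig U))
          (trivialMeasure (Matrix.specialUnitaryGroup (Fin 2) ℂ) d L) w) (x k) *
      (((x k + (x (k + 1) - x k) / (1 - η) : ℝ) : ℂ) - x k) ^ j) :
    Real.log ((x K + 8) / (x 0 + 8)) ≤ K * Real.log (1 / η) := by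
  have h := wilson_staircase_count_ge_log (d := d) (L := L) (n := 2) hd le_rfl hL hη0 hη1 hx0
    hmono hadm
  rw [haarSqReTrace_su2] at h
  have h8 : (4 : ℝ) * (2 : ℕ) / 1 = 8 := by norm_num
  rwa [h8] at h

/-- **`SU(n)`, `n ≥ 3`: `log((x_K + 8n)/(x₀ + 8n)) ≤ K·log(1/η)`** in every volume `L ≥ 2`
(`d ≥ 2`). [ours] -/
theorem wilson_sun_staircase_count_ge_log (hd : 2 ≤ d) (hn : 3 ≤ n) (hL : 2 ≤ L)
    {η : ℝ} (hη0 : 0 < η) (hη1 : η < 1) {K : ℕ} {x : ℕ → ℝ} (hx0 : 0 ≤ x 0)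
    (hmono : ∀ k < K, x k ≤ x (k + 1))
    (hadm : ∀ k < K, Summable fun j : ℕ => (j.factorial : ℂ)⁻¹ *
      iteratedDeriv j (fun w => deriv (complexMGF (fun U => -ambWilsonAction (coeConfig U))
          (trivialMeasure (Matrix.specialUnitaryGroup (Fin n) ℂ) d L)) w /
        complexMGF (fun U => -ambWilsonAction (coeConfig U))
          (trivialMeasure (Matrix.specialUnitaryGroup (Fin n) ℂ) d L) w) (x k) *
      (((x k + (x (k + 1) - x k) / (1 - η) : ℝ) : ℂ) - x k) ^ j) :
    Real.log ((x K + 8 * n) / (x 0 + 8 * n)) ≤ K * Real.log (1 / η) := by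
  have h := wilson_staircase_count_ge_log (d := d) (L := L) (n := n) hd (by omega) hL hη0 hη1 hx0
    hmono hadm
  rw [haarSqReTrace_eq_half hn] at h
  have h8 : (4 : ℝ) * n / (1 / 2) = 8 * n := by ring
  rwa [h8] at h

end Wilson

end Summit.Ventures.LatticeQCDFlow.TrivializingMaps
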